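import Summits.Ventures.CertifiedManyBodySolver.Theses.TcThermcert1
import Summits.Ventures.CertifiedManyBodySolver.Theorems.TcThermcert1SeamStationarity
import Summits.Ventures.CertifiedManyBodySolver.Theorems.TcThermcert1SeamTwistInputs
import Summits.Ventures.CertifiedManyBodySolver.Theorems.TcThermcert1FarCutCurrentOfClustering
import Literature.MathematicalPhysics.QuantumLattice.HubbardNNNHoppingFluxThermal
import Literature.MathematicalPhysics.QuantumLattice.FermionLiebRobinson
import Literature.MathematicalPhysics.QuantumLattice.LatticeTori
import HarnessLib

/-!
# LINE `gauge_qbp_far_seam` v1.4, K1 twin `gauge_qbp_far_seam_b10` — from crux idea `gauge-qbp-far-seam` (KEEP · NEW-MECHANISM, hubbard-floor-crit-1 g6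
2026-08-29T12:41Z; A1–A6 PASS, crit-2 g5) on K1′ = `TcThermcert1.ThermalStiffnessCeilingU8b8_le_7o44`
(stmt-Ventures-24560) and K1 = `TcThermcert1.ThermalStiffnessCeilingU8b10_le_1o8` (stmt-Ventures-26381).
v1.4 (prover hub-tc-therm-sw-1 g0, 2026-08-29): STUB B PROVED — `stub_farCutCurrent_of_clustering` is now a THEOREM whose body is the
hypothesis-form assembly `Theorems/TcThermcert1FarCutCurrentOfClustering.lean` (`farCutCurrent_vanishes_of_currentClustering`, over this file's
unfolded §0–§1 objects; parts `…FarCutGeometry`, `…FarCutPerBond`, `…FarCutAsymptotics`) on top of the landed QBP chain `Theorems/TcThermcert1Qbp*`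
(parts 1–6, 7a–7e, hubbard-floor-idea-rescuer g14) and `Literature/…/QBPWeight.lean`; the ONLY remaining registered stub is the bet
(`stub_currentClustering8` here / `stub_currentClustering10` in the twin). Planner hubbard-floor-idea-rescuer g12 (v1, v1.1), g13 (v1.2: stub A′ PROVED — `Theorems/TcThermcert1SeamStationarity.lean`; v1.3: stub-B
inputs landed — `Theorems/TcThermcert1SeamTwistInputs.lean`: the time-reversal baseline `farCutCurrent_zero` (PROVED, §3), the `H + V` splitting
`hubbardTorusTT'Flux L 0 U φ = hubbardTorusTT'Flux L 0 U 0 + seamTwist L φ` and the Peierls coefficient modulus `|1 − e^{±iφ}| = 2|sin(φ/2)| ≤ |φ|`).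

HONEST FRAMING. KT-type CEILINGS under a hypothesis; nothing here is a lower bound on `T_c`, a number of
record, or a proof of superconductivity in the Hubbard model. The hypothesis `CurrentClustering` is a BET
(registered as the stub `stub_currentClustering10` here, β·t = 10; `stub_currentClustering8` in the K1′ file, β·t = 8).

THE LEVER (persistent current read at the far cut × quantum-belief-propagation local stability).
* CURRENT FORMULA (PROVED, v1.1) + STATIONARITY (A′, PROVED v1.2: an exact finite-dimensional identity). With the
  seam at the column cut `0` exactly as in the tree (`hubbardTorusTT'Flux L 0 U φ = hubbardTorusTT' L 1 0 U + seamTwist L φ`),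
  `∂_φ log Re Z_p(φ) = −β Re⟨(∂_φ seamTwist L φ)|_p⟩_{p,φ}` and the mean value theorem give
  `|thermalFluxLogZ(0) − thermalFluxLogZ(θ)| ≤ β θ₁ sup_{|φ|≤θ₁} |Re⟨seamCurrentOp L φ⟩_{p,φ}|` — LANDED:
  `Theorems/TcThermcert1GibbsCurrentFormula.lean` (p720870, model-free) and `Theorems/TcThermcert1SeamTwistCost.lean`
  (`hasDerivAt_seamTwist`: `∂_φ seamTwist =` the explicit seam-current sum, named `seamCurrentOp` in §0 here; `abs_thermalFluxLogZ_sub_le_of_seamCurrent_bound`). The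
  STATIONARITY IDENTITY (A′, v1's remaining half of stub A) is LANDED too (v1.2): `Theorems/TcThermcert1SeamStationarity.lean` proves, for
  `L ≥ 3` and the half torus `S = {0 ≤ x₁ < ⌊L/2⌋}`, `i[H(φ), N_S] = Σ_y j_{⌊L/2⌋,y} − seamCurrentOp L φ` (CAR bookkeeping
  `[c†_p c_q, N_S] = (χ_S q − χ_S p) c†_p c_q`; only the seam bonds and the far-cut bonds cross `∂S`; the `U` term commutes) and, with
  `⟨[H, N_S]|_p⟩_{p,φ} = 0` (`gibbsState_toBlock_commutator_eq_zero`, `N_S` diagonal), `⟨seamCurrentOp L φ⟩_{p,φ} = Σ_y ⟨j_{⌊L/2⌋,y}⟩_{p,φ}`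
  in EVERY coordinate sector (`gibbsState_fluxBlock_seamCurrent_eq_sum_farBond`) — the persistent current may be READ AT ANY CUT; we read
  it at the antipodal cut `X = ⌊L/2⌋` (`farCutCurrent`; `seamCurrent_eq_farCutCurrent` below, `L₀ = 3`). Then `|Δ_θ thermalFluxLogZ| ≤ β θ₁ ε_L → 0`
  = `TwistInsensitiveAt` (`twistCost_of_farCutCurrent`, PROVED), and the PROVED socket `leafAtBeta_of_twistInsensitiveAt` gives the
  leaf for every `c ≥ 0`. So the line is now (v1.4): (C, the bet) ⇒ K1′ / K1, everything else kernel-checked (B landed as four Theorems files).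
  (v1 TYPING DELTA w.r.t. the card: the card relocated the SEAM to the antipode and read the current at cut 0 —
  Byers–Yang gauge covariance; v1 keeps the tree's seam and relocates the OBSERVABLE instead, which is the same
  statement after a translation and needs no gauge-relocation lemma.)
* QBP (stub B, size L, THE WORK). `farCutCurrent(φ) = Σ_y [⟨j_{X,y}⟩_{H₀+V_φ} − ⟨j_{X,y}⟩_{H₀}]`
  (`⟨j⟩_{H₀} = 0` by time reversal: `H₀` real, `j` imaginary-antisymmetric), `V_φ = seamTwist L φ` supported on
  the columns `{−1, 0}`, at torus distance `≥ ⌊L/2⌋ − 1` from the bond, `‖V_φ‖ ≤ C·L|φ|`.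
  Capel–Moscolari–Teufel–Wessel, CMP 406 (2025) = arXiv:2310.09182, Thm 14 (LPPL from correlations in the
  UNPERTURBED state; fermionic version §5 remark p. 12), with the factor `e^{2β‖V‖}` on BOTH terms (crit-1 SHARPEN):
  `|⟨B⟩_{H+V} − ⟨B⟩_H| ≤ e^{2β‖V‖} [‖B‖ Cov_{ρ_β(H)}(X_r ; B) + 4β‖V‖‖B‖ ζ_QBP(X, r)]`, via the exact
  intertwiner `e^{−β(H+V)} = η e^{−βH} η*` (Hastings 2007, arXiv:0706.4094), its Lieb–Robinson localisation
  `η_r` (tree: `fermion_lieb_robinson_hamiltonianWith`; QBP decay rate `μ_QBP(β)` of CMTW Remark 12) and ONE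
  covariance `Cov_ρ(η_r* η_r, B)` in the flux-FREE state; `η` conserves `N↑, N↓`, so everything restricts to the
  canonical sector. BUDGET with `r = L/4`: `|farCutCurrent(φ)| ≤ 2L·e^{2βCL|φ|}[C′ L^{2k} e^{−L/(4ξ)} + 8βCL|φ| ζ(L/4)]
  → 0` once `|φ| ≤ θ₁ := min(1/ξ, μ_QBP(β)) / (64 C β)` — hence stub B concludes `∃ θ₁ > 0` (SHARPEN applied).
  The exponential cost is `e^{O(βLφ)}`, NOT `e^{βtL}`: proportional to the flux, and the leaf socket consumes the
  flux premise at ONE positive twist as small as we please (`Disproof.k1_false_without_theta0_pos/_fluxPremise`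
  honoured: the line USES `0 < θ₀` and the flux premise at `θ = min θ₀ θ₁`).

THIS FILE = the K1 twin (β·t = 10; registered on stmt-Ventures-26381) of `Lines/gauge_qbp_far_seam.lean` (the K1′ skeleton, stmt-Ventures-24560):
§0–§3 byte-identical, same namespace (the two files are never imported together). REGISTERED STUB (sorried, v1.4): `stub_currentClustering10`
(C10, the weaker-supported bet at β·t = 10) ONLY; B `stub_farCutCurrent_of_clustering` (v1.4), A′ `seamCurrent_eq_farCutCurrent` and v1's A
`twistCost_of_farCutCurrent` are THEOREMS (v1.4 / v1.2 / v1.1). SKELETON THEOREM (0 sorry; the ONLY theorem concluding the route decl BY NAME, zero hypotheses — A12):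
`ThermalStiffnessCeilingU8b10_le_1o8_of_stubs`; the hypothesis-form composition `leafAtBeta_of_ABC` concludes the leaf BODY at any `β > 0`,
every `c ≥ 0`. K1′ is ranked FIRST (print counter-indicates clustering at β·t = 10: arXiv:2202.11741 p.6, p.9).
FIRST RUNG worth landing (crit-1): `CurrentClustering 0 n β ξ_T` (U = 0: Wick + Darroch, free-gas current clustering).
-/

noncomputable section

namespace Summit.Ventures.CertifiedManyBodySolver.Cruxes.ThermalStiffnessCeilingU8b10_le_1o8.GaugeQbpFarSeam

open Filter Topology Set Real Matrix
open Literature.MathematicalPhysics.QuantumLattice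
open Literature.Probability.LatticeModels
open Summit.Ventures.CertifiedManyBodySolver.Observables
open Summit.Ventures.CertifiedManyBodySolver.Theorems.TcThermcert1.GaugeQbpFarSeam
open scoped Matrix.Norms.L2Operator ComplexOrder ComplexConjugate

/-! ## §0 Objects -/

section Objects

variable (L : ℕ) [NeZero L]

/-- Operators on the fermionic Fock space of the two-spin torus `(ℤ/Lℤ)²` (Jordan–Wigner coordinates). -/
abbrev FockOp : Type := Matrix (Finset (Orb (FermionTorus 2 L))) (Finset (Orb (FermionTorus 2 L))) ℂ

/-- The canonical `(N_L, S^z = 0)` coordinate sector at hole density `δ` — verbatim the binder inside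
`thermalFluxLogZ` (`N_L = 2⌊(1-δ)L²/2⌋`). -/
abbrev sectorPred (δ : ℝ) : Finset (Orb (FermionTorus 2 L)) → Prop :=
  fun s => s.card = 2 * ⌊(1 - δ) * (L : ℝ) ^ 2 / 2⌋₊ ∧
    2 * (s.filter fun i => (ofLex i).2 = 0).card = 2 * ⌊(1 - δ) * (L : ℝ) ^ 2 / 2⌋₊

/-- Sector-preserving operator: no matrix element between the sector and its complement
(e.g. every polynomial in `c†_{iσ} c_{jσ}`). -/
def SectorPreserving (δ : ℝ) (A : FockOp L) : Prop :=
  ∀ s t, sectorPred L δ s → ¬ sectorPred L δ t → A s t = 0 ∧ A t s = 0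

/-- Expectation of (the sector compression of) `A` in the canonical Gibbs state of (the sector compression
of) the Fock Hamiltonian `H` at inverse temperature `β`. -/
def sectorExpect (δ β : ℝ) (H A : FockOp L) : ℂ :=
  gibbsState β (H.toBlock (sectorPred L δ) (sectorPred L δ)) (A.toBlock (sectorPred L δ) (sectorPred L δ))

/-- The PLAIN (untwisted, `t = 1`) bond current on `(X−1,y) → (X,y)`, both spins:
`j_{X,y} = Σ_σ (−i c†_{(X,y)σ} c_{(X−1,y)σ} + i c†_{(X−1,y)σ} c_{(X,y)σ})` (`= i[−(c†c + h.c.), N_{x₁<X}]`,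
the Heisenberg rate of change of the charge of column `X−1` through this bond, i.e. the particle current
from column `X` into column `X−1` (minus the `+e₁`-oriented current); at `X = 0` it is `∂_θ seamTwist L θ |_{θ=0}`,
and `seamCurrentOp` below carries the same orientation, so A′ is an identity between like-oriented currents). -/
def bondCurrent (X y : ZMod L) : FockOp L :=
  ∑ σ : Fin 2,
    ((-Complex.I) • (creation (orb (FermionTorus.ofTorusSite ![X, y]) σ) *
        annihilation (orb (FermionTorus.ofTorusSite ![X - 1, y]) σ)) +
      Complex.I • (creation (orb (FermionTorus.ofTorusSite ![X - 1, y]) σ) *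
        annihilation (orb (FermionTorus.ofTorusSite ![X, y]) σ)))

/-- The antipodal column `⌊L/2⌋` (a cut `≠ 0` as soon as `L ≥ 2`; at torus distance `⌊L/2⌋ − 1` from the seam). -/
def antipode : ZMod L := ((L / 2 : ℕ) : ZMod L)

/-- **Far-cut persistent current** `I_L(β,φ)`: the plain current through the ANTIPODAL cut `X = ⌊L/2⌋`, summed
over its `L` bonds, in the canonical Gibbs state of the flux-`φ` torus whose seam sits at the cut `0` (the tree's
`hubbardTorusTT'Flux L 0 U φ`). By the current formula and stationarity (stub A) this is
`−β⁻¹ ∂_φ thermalFluxLogZ L 0 U (1−n) β φ` for `L ≥ 3`. -/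
def farCutCurrent (U n β φ : ℝ) : ℝ :=
  ∑ y : ZMod L, (sectorExpect L (1 - n) β (hubbardTorusTT'Flux L 0 U φ) (bondCurrent L (antipode L) y)).re

/-- The **phase-dressed seam current operator** `seamCurrentOp L θ := ∂_θ seamTwist L θ`
`= Σ_{y,σ,b} (−s_b i e^{s_b iθ}) c†_{…σ} c_{…σ}` (`s_b = ±1`): verbatim the derivative of `hasDerivAt_seamTwist`
(Theorems/TcThermcert1SeamTwistCost.lean, which makes no definition); at `θ = 0` it equals `Σ_y bondCurrent L 0 y`. -/
def seamCurrentOp (θ : ℝ) : FockOp L :=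
  ∑ y : ZMod L, ∑ σ : Fin 2, ∑ b : Bool,
    (-((if b then 1 else -1) * Complex.I) * Complex.exp ((if b then 1 else -1) * Complex.I * θ)) •
      (creation (orb (FermionTorus.ofTorusSite ![if b then 0 else -1, y]) σ) *
        annihilation (orb (FermionTorus.ofTorusSite ![if b then -1 else 0, y]) σ))

end Objects

/-! ## §1 The hypothesis (THE BET) and the intermediate statement -/

/-- **Hypothesis C — uniform exponential clustering of the flux-FREE canonical sector Gibbs state at `β`
AGAINST THE CUT CURRENTS (every cut).** For all large `L`, every cut `X₀ : ZMod L`, every row `y`, every even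
(`carEvenSubalgebra`) sector-preserving observable `A` supported on a site set `X` at torus (sup-)distance `≥ d`
from both ends of the bond `(X₀−1,y)–(X₀,y)`: the connected correlation of `A` with the plain bond current
`j_{X₀,y}` is bounded by `C ‖A‖ |X|^k e^{−d/ξ}`, in the Gibbs state of `hubbardTorusTT'Flux L 0 U 0` (`=` the
translation-invariant `t–U` torus: the seam term vanishes at `θ = 0`) compressed to the `(N_L, S^z=0)` sector,
`N_L = 2⌊nL²/2⌋`. (v1: stated for every cut `X₀` — by translation invariance the same statement as the card's
cut-`0` form; stub B consumes it at `X₀ = antipode L`.) This is exactly the ONE covariance `Cov_{ρ₀}(η_r^* η_r ; j)`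
that Capel–Moscolari–Teufel–Wessel Thm 14 consumes (Def. 1 form, `|X|`-polynomial growth, FLUX-FREE state only —
no twisted state, no complex parameter). Deliberately NOT stated for a general second observable `B`: canonical
density–density covariances carry the Lebowitz–Percus `−χ/L²` plateau, whereas every `N`-cumulant correction
against the time-reversal-ODD current vanishes (`⟨j⟩_{GC,μ} ≡ 0`). -/
def CurrentClustering (U n β ξ : ℝ) : Prop :=
  0 < ξ ∧ ∃ C : ℝ, ∃ k L₀ : ℕ, ∀ (L : ℕ) [NeZero L], L₀ ≤ L →
    ∀ (X : Finset (FermionTorus 2 L)) (A : FockOp L),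
      A ∈ carEvenSubalgebra (orbSet X) → SectorPreserving L (1 - n) A →
      ∀ (X₀ y : ZMod L) (d : ℕ),
        (∀ x ∈ X, d ≤ torusDist x.toTorusSite ![X₀, y] ∧
          d ≤ torusDist x.toTorusSite ![X₀ - 1, y]) →
        ‖sectorExpect L (1 - n) β (hubbardTorusTT'Flux L 0 U 0) (A * bondCurrent L X₀ y)
            - sectorExpect L (1 - n) β (hubbardTorusTT'Flux L 0 U 0) A
              * sectorExpect L (1 - n) β (hubbardTorusTT'Flux L 0 U 0) (bondCurrent L X₀ y)‖
          ≤ C * ‖A‖ * (X.card : ℝ) ^ k * Real.exp (-(d : ℝ) / ξ)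

/-- **Vanishing far-cut persistent current** on the flux window `|φ| ≤ θ₁`, uniformly: `|I_L(β,φ)| ≤ ε_L → 0`. -/
def PersistentCurrentVanishes (U n β θ₁ : ℝ) : Prop :=
  ∃ ε : ℕ → ℝ, Tendsto ε atTop (𝓝 0) ∧ ∃ L₀ : ℕ, ∀ (L : ℕ) [NeZero L], L₀ ≤ L →
    ∀ φ : ℝ, |φ| ≤ θ₁ → |farCutCurrent L U n β φ| ≤ ε L

/-! ## §2 The socket (copied VERBATIM from `Lines/zerofree_corridor.lean` §F, PROVED there and here) -/

/-- Qualitative twist-insensitivity of the `(N_L, S^z=0)` sector free energy at inverse temperature `β`. -/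
def TwistInsensitiveAt (tp U n β : ℝ) : Prop :=
  ∃ θ₁ : ℝ, 0 < θ₁ ∧ ∃ ε : ℕ → ℝ, Tendsto ε atTop (𝓝 0) ∧ ∃ L₀ : ℕ,
    ∀ (L : ℕ) [NeZero L], L₀ ≤ L → ∀ θ : ℝ, |θ| ≤ θ₁ →
      |thermalFluxLogZ L tp U (1 - n) β 0 - thermalFluxLogZ L tp U (1 - n) β θ| ≤ ε L

/-- **Socket (PROVED).** Twist-insensitivity at `β > 0` forces the single-temperature leaf for every `c ≥ 0`
(the flux premise is consumed at the positive twist `θ = min θ₀ θ₁`). -/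
theorem leafAtBeta_of_twistInsensitiveAt {tp U n β : ℝ} (hβ : 0 < β) {c : ℚ} (_hc : 0 ≤ c)
    (h : TwistInsensitiveAt tp U n β) : ObsThermalStiffnessSeqCeilingAtBeta tp U n β c := by
  intro ρs θ₀ hρs hθ₀ Ls hLs hst
  obtain ⟨θ₁, hθ₁, ε, hε, L₀, hins⟩ := h
  exfalso
  set θ : ℝ := min θ₀ θ₁ with hθdef
  have hθpos : 0 < θ := lt_min hθ₀ hθ₁
  have hθ0 : |θ| ≤ θ₀ := by rw [abs_of_pos hθpos]; exact min_le_left _ _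
  have hθ1 : |θ| ≤ θ₁ := by rw [abs_of_pos hθpos]; exact min_le_right _ _
  have hev : ∀ᶠ j in atTop, β * ρs * θ ^ 2 ≤ ε (Ls j) := by
    have h1 : ∀ᶠ j in atTop, max 1 L₀ ≤ Ls j := hLs.eventually (eventually_ge_atTop (max 1 L₀))
    filter_upwards [h1] with j hj
    haveI : NeZero (Ls j) := ⟨by omega⟩
    have ha := hst j θ hθ0
    have hb := hins (Ls j) (le_of_max_le_right hj) θ hθ1
    exact ha.trans ((le_abs_self _).trans hb)
  have hlim : Tendsto (fun j => ε (Ls j)) atTop (𝓝 0) := hε.comp hLs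
  have hle : β * ρs * θ ^ 2 ≤ 0 := ge_of_tendsto hlim hev
  have hpos : 0 < β * ρs * θ ^ 2 := by positivity
  linarith

/-! ## §3 A′ (stationarity, PROVED v1.2) with v1's stub A PROVED from it, and B (the CMTW port, PROVED v1.4) -/

/-- **A′ — the stationarity identity, PROVED (v1.2; v1.1's registered stub `stub_seamCurrent_eq_farCutCurrent`), `L₀ = 3`.**
In the canonical-sector Gibbs state of the flux torus `hubbardTorusTT'Flux L 0 U φ` (seam at the cut `0`) the expectation of the
phase-dressed seam current `seamCurrentOp L φ = ∂_φ seamTwist L φ` equals the far-cut persistent current `farCutCurrent L U n β φ`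
(the plain current through the antipodal cut `⌊L/2⌋`). Mechanism (landed as `Theorems/TcThermcert1SeamStationarity.lean`): with
`N_S = Σ_{0 ≤ x₁ < ⌊L/2⌋, y, σ} n_{(x₁,y)σ}` (diagonal in the occupation basis), `[c†_a c_b, N_S] = (χ_S b − χ_S a) c†_a c_b` gives
`i[H_L(φ), N_S] = Σ_y bondCurrent L ⌊L/2⌋ y − seamCurrentOp L φ` (seam bonds `(0,y) ∈ S`, `(−1,y) ∉ S` with hopping
`−e^{iφ} c†c − e^{−iφ} h.c.`; far-cut bonds `(⌊L/2⌋−1,y) ∈ S`, `(⌊L/2⌋,y) ∉ S`; the `U` term, the vertical bonds and every other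
horizontal bond commute with `N_S`; `t′ = 0`), and `⟨([H, N_S])|_p⟩_{β, H|_p} = 0` (`gibbsState_toBlock_commutator_eq_zero`)
plus linearity finish (`gibbsState_fluxBlock_seamCurrent_eq_sum_farBond`, every coordinate sector `p`). -/
theorem seamCurrent_eq_farCutCurrent {U n β : ℝ} :
    ∃ L₀ : ℕ, ∀ (L : ℕ) [NeZero L], L₀ ≤ L → ∀ φ : ℝ,
      (sectorExpect L (1 - n) β (hubbardTorusTT'Flux L 0 U φ) (seamCurrentOp L φ)).re = farCutCurrent L U n β φ := by
  refine ⟨3, fun L _ hL φ => ?_⟩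
  unfold farCutCurrent sectorExpect seamCurrentOp bondCurrent antipode
  rw [gibbsState_fluxBlock_seamCurrent_eq_sum_farBond L hL U β φ (sectorPred L (1 - n)), Complex.re_sum]

/-- **Time-reversal baseline (PROVED, v1.3; helper `Theorems/TcThermcert1SeamTwistInputs.lean`).** The flux-FREE far-cut current
vanishes in every sector and every volume: `farCutCurrent L U n β 0 = 0` (`hubbardTorusTT'Flux L 0 U 0` is an entrywise real matrix, the
plain bond current an entrywise imaginary one: `re_gibbsState_eq_zero_of_map_starRingEnd`). So the persistent current of stub B is a pure
RESPONSE to the seam perturbation `V_φ = seamTwist L φ` (`hubbardTorusTT'Flux_zero_eq_add_seamTwist`), the `⟨j⟩_{H₀} = 0` input of the CMTW bound. -/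
theorem farCutCurrent_zero (L : ℕ) [NeZero L] (U n β : ℝ) : farCutCurrent L U n β 0 = 0 := by
  unfold farCutCurrent sectorExpect bondCurrent antipode
  exact sum_re_gibbsState_fluxZeroBlock_farBond_eq_zero L U β _ _

/-- **Twist cost from the far-cut current — v1's stub A, PROVED in v1.1** from the stationarity identity (hypothesis `hA`,
= A′, itself proved in v1.2 as `seamCurrent_eq_farCutCurrent`) and the landed calculus: `∂_φ log Re Z_p = −β Re⟨(∂_φ seamTwist)|_p⟩` + the mean value theorem
(`abs_thermalFluxLogZ_sub_le_of_seamCurrent_bound`) + `|I_L(β,φ)| ≤ ε_L` on `|φ| ≤ θ₁` ⇒ `|Δ_θ thermalFluxLogZ| ≤ β ε_L θ₁ → 0`. -/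
theorem twistCost_of_farCutCurrent {U n β θ₁ : ℝ} (hβ : 0 < β) (hθ₁ : 0 < θ₁)
    (hA : ∃ L₀ : ℕ, ∀ (L : ℕ) [NeZero L], L₀ ≤ L → ∀ φ : ℝ,
      (sectorExpect L (1 - n) β (hubbardTorusTT'Flux L 0 U φ) (seamCurrentOp L φ)).re = farCutCurrent L U n β φ)
    (h : PersistentCurrentVanishes U n β θ₁) : TwistInsensitiveAt 0 U n β := by
  obtain ⟨ε, hε, L₀, hP⟩ := h
  obtain ⟨L₁, hstat⟩ := hA
  refine ⟨θ₁, hθ₁, fun L => β * ε L * θ₁, ?_, max L₀ L₁, ?_⟩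
  · simpa using (hε.const_mul β).mul_const θ₁
  · intro L _ hL θ hθ
    refine abs_thermalFluxLogZ_sub_le_of_seamCurrent_bound L (J := seamCurrentOp L)
      (fun t => hasDerivAt_seamTwist L t) hβ.le (fun φ hφ => ?_) hθ
    have h1 := hstat L (le_of_max_le_right hL) φ
    have h2 := hP L (le_of_max_le_left hL) φ hφ
    rw [← h1] at h2
    exact h2

/-- **B — the Capel–Moscolari–Teufel–Wessel port, PROVED (v1.4; was the registered stub `stub_farCutCurrent_of_clustering`, size L).**
Flux-free current clustering at `β` gives a flux window `θ₁ = min(1/2, 1/(96βξ), 1/(192β), π/(8448·e·(3+|U|)·β²)) > 0` on which the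
far-cut persistent current is bounded by `ε_L → 0`. Mechanism (landed as `Theorems/TcThermcert1FarCut{Geometry,PerBond,Asymptotics,
CurrentOfClustering}.lean`, assembling the QBP chain `Theorems/TcThermcert1Qbp*` parts 1–6, 7a–7e and `Literature/…/QBPWeight.lean`):
quantum belief propagation `e^{−β(H₀+V_φ)} = E e^{−βH₀} Eᴴ` on the full Fock space (`V_φ = seamTwist L φ`, `‖V_φ‖ ≤ 4L|φ|`, weight `f_β`
with ‖f_β‖₁ = 1, tail `e^{−πT/β}`), a second conjugation `Ẽ` of the dynamics RESTRICTED to the collar `|x₁|_∘ ≤ ⌊L/4⌋` (Lieb–Robinson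
leakage of part 7e at the cut-off `T_L = (⌊L/4⌋−2)/(88e(3+|U|))`), `Ẽ` even and supported in the collar hence commuting with the far
current, compression to the sector (part 5: `|ω_φ(j) − ω_0(j)| ≤ e^{β‖V‖}(cov + 16Rδ)`), ONE instance of Hypothesis C with the test
observable `ẼᴴẼ` at distance `⌊L/2⌋−1−⌊L/4⌋`, time reversal `ω_0(j) = 0` (`farCutCurrent_zero`), the sum over the `L` bonds of the
antipodal cut, and the majorant `K_A L^{2k+1}e^{−L/(8ξ)} + K_B L^{12}e^{−L/16} + K_C L²e^{−πL/(704e(3+|U|)β)} → 0`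
(arXiv:2310.09182 Prop 6, Thm 14 with `e^{2β‖V‖}`-type costs on both terms — flux-proportional, beaten on the window). The Theorems
side states the implication over this file's UNFOLDED objects for any union-of-sectors predicate family; here it is instantiated at
`p L = sectorPred L (1 − n)`. -/
theorem stub_farCutCurrent_of_clustering {U n β ξ : ℝ} (hβ : 0 < β)
    (h : CurrentClustering U n β ξ) : ∃ θ₁ : ℝ, 0 < θ₁ ∧ PersistentCurrentVanishes U n β θ₁ := by
  unfold CurrentClustering SectorPreserving sectorExpect bondCurrent at h
  unfold PersistentCurrentVanishes farCutCurrent sectorExpect bondCurrent antipode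
  exact farCutCurrent_vanishes_of_currentClustering (fun L => sectorPred L (1 - n))
    (fun L _ X hX => sectorPreserving_of_preservesSectors hX _) hβ h

/-! ## §4 The bet (registered stub C10) and the skeleton theorem -/

/-- **STUB C10 — THE (weaker-supported) BET at `β·t = 10` (K1).** Hypothesis C holds at `(t′,U,n,β) = (0,8,7/8,10)` for some
`ξ > 0`. Why it might fail: print (arXiv:2202.11741 p.6, p.9) reports a stripe nodal line from `β = 9` and domains at `β = 10, 12` at
`(U,δ,t′) = (8,1/8,0)` — quasi-long-range current correlations at `T = t/10` would make it false; kept because the composition is verbatim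
(K1′ at β·t = 8 is ranked first). -/
theorem stub_currentClustering10 : ∃ ξ : ℝ, CurrentClustering 8 (7 / 8) 10 ξ := by
  sorry

/-- Hypothesis C at `β` ⇒ twist-insensitivity at `β` (B, then the proved twist cost fed by the proved A′). -/
theorem twistInsensitiveAt_of_currentClustering {U n β ξ : ℝ} (hβ : 0 < β)
    (h : CurrentClustering U n β ξ) : TwistInsensitiveAt 0 U n β := by
  obtain ⟨θ₁, hθ₁, hP⟩ := stub_farCutCurrent_of_clustering hβ h
  exact twistCost_of_farCutCurrent hβ hθ₁ seamCurrent_eq_farCutCurrent hP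

/-- Hypothesis C at `β > 0` ⇒ the single-temperature leaf at the anchor with EVERY constant `c ≥ 0`
(stated on the leaf BODY, not on a route decl — A12 lesson). -/
theorem leafAtBeta_of_currentClustering {β ξ : ℝ} (hβ : 0 < β) {c : ℚ} (hc : 0 ≤ c)
    (h : CurrentClustering 8 (7 / 8) β ξ) : ObsThermalStiffnessSeqCeilingAtBeta 0 8 (7 / 8) β c :=
  leafAtBeta_of_twistInsensitiveAt hβ hc (twistInsensitiveAt_of_currentClustering hβ h)

/-- **COMPOSITION (hypothesis form, 0 sorry): A′ → B → C(β) → the leaf BODY at `β` with every `c ≥ 0`.** Stated on the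
leaf body `ObsThermalStiffnessSeqCeilingAtBeta …`, NOT on a route decl (A12 lesson: the only theorem concluding the route decl
BY NAME is the zero-hypothesis skeleton theorem below). -/
theorem leafAtBeta_of_ABC {β : ℝ} (hβ : 0 < β) {c : ℚ} (hc : 0 ≤ c)
    (hA : ∀ {U n β : ℝ}, ∃ L₀ : ℕ, ∀ (L : ℕ) [NeZero L], L₀ ≤ L → ∀ φ : ℝ,
      (sectorExpect L (1 - n) β (hubbardTorusTT'Flux L 0 U φ) (seamCurrentOp L φ)).re = farCutCurrent L U n β φ)
    (hB : ∀ {U n β ξ : ℝ}, 0 < β → CurrentClustering U n β ξ → ∃ θ₁ : ℝ, 0 < θ₁ ∧ PersistentCurrentVanishes U n β θ₁)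
    (hC : ∃ ξ : ℝ, CurrentClustering 8 (7 / 8) β ξ) :
    ObsThermalStiffnessSeqCeilingAtBeta 0 8 (7 / 8) β c := by
  obtain ⟨ξ, h⟩ := hC
  obtain ⟨θ₁, hθ₁, hP⟩ := hB hβ h
  exact leafAtBeta_of_twistInsensitiveAt hβ hc (twistCost_of_farCutCurrent hβ hθ₁ hA hP)

/-- **SKELETON THEOREM (K1 BY NAME from exactly the registered stub C10 and the proved A′, B; 0 sorry outside the stub).** -/
theorem ThermalStiffnessCeilingU8b10_le_1o8_of_stubs :
    Summit.Ventures.CertifiedManyBodySolver.Theses.TcThermcert1.ThermalStiffnessCeilingU8b10_le_1o8 :=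
  leafAtBeta_of_ABC (β := 10) (by norm_num) (by norm_num)
    seamCurrent_eq_farCutCurrent
    (fun hβ h => stub_farCutCurrent_of_clustering hβ h) stub_currentClustering10

/-- Unconditional-in-form version (consumes the stubs of this file; concludes the leaf BODY at β·t = 10 with `c = 0`). -/
theorem leaf10_c0 : ObsThermalStiffnessSeqCeilingAtBeta 0 8 (7 / 8) 10 0 := by
  obtain ⟨ξ, h⟩ := stub_currentClustering10
  exact leafAtBeta_of_currentClustering (by norm_num) le_rfl h

end Summit.Ventures.CertifiedManyBodySolver.Cruxes.ThermalStiffnessCeilingU8b10_le_1o8.GaugeQbpFarSeam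

end
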